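import Mathlib
import Literature.NumberTheory.LFunctions.WeilExplicit
import HarnessLib

/-!
# RiemannHypothesis / WeilGroundState — weak lower semicontinuity of weighted `L¹` norms

Route `RiemannHypothesis/WeilGroundState`, crux item stmt-RiemannHypothesis-1527
(`GroundStatesConvergeToXi`), line `Sketch`, registered stub (H5)
`stub_weightedL1_of_weakLimit` (helper file, `--supports`).

**Statement.** Let `f_k : ℝ → ℂ` satisfy `∫ ‖f_k(t)‖ e^{b|t|} dt ≤ M` for all `k`, and let
`v : ℝ → ℂ` be locally integrable with `∫ f_k g → ∫ v g` for every Weil test function `g`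
(smooth of compact support). Then `t ↦ ‖v t‖ e^{b|t|}` is integrable and
`∫ ‖v(t)‖ e^{b|t|} dt ≤ M` (weighted `L¹` norms are weakly lower semicontinuous).

**Proof.** Pure measure theory. Fix `R` and test against the bounded compactly supported phase
`φ = 𝟙_{[-R,R]} · e^{b|t|} · v̄/|v|` (so `v φ = 𝟙_{[-R,R]} |v| e^{b|t|}` and `|φ| ≤ e^{b|t|}`),
mollified by normalised bumps `ψ_n` of outer radius `r_n = 1/(n+1)`: `g_n = ψ_n ⋆ φ` is a Weil
test function with `|g_n(t)| ≤ e^{b|t| + |b| r_n}` (`dist_convolution_le` and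
`e^{b|s|} ≤ e^{b|t| + |b||s-t|}`), whence `‖∫ f_k g_n‖ ≤ e^{|b| r_n} M` and, by the weak limit,
`‖∫ v g_n‖ ≤ e^{|b| r_n} M`. As `n → ∞`, `g_n → φ` a.e. (Lebesgue differentiation,
`ContDiffBump.ae_convolution_tendsto_right_of_locallyIntegrable`), dominated by
`𝟙_{[-R-1,R+1]} e^{b|t|+|b|}`, so `∫ v g_n → ∫ v φ = ∫_{[-R,R]} |v| e^{b|t|}` and this is `≤ M`.
Finally `R → ∞` through the `AECover` `[-n, n]`
(`AECover.integrable_of_integral_bounded_of_nonneg_ae`, `AECover.integral_tendsto_of_countably_generated`).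

Mathlib + `Literature.NumberTheory.LFunctions.WeilExplicit` (`IsWeilTest`) only; no named fact is
used; no definitions.
-/

noncomputable section

set_option linter.dupNamespace false

open MeasureTheory Complex Filter Set
open scoped Real Topology ENNReal ComplexConjugate Convolution ContDiff

namespace Summit.RiemannHypothesis.RiemannHypothesis.Theorems.GroundStatesConvergeToXi

open Literature.NumberTheory.LFunctions

/-- The phase `z̄/|z|` (which is `0` at `z = 0`) has modulus at most `1`. [folklore] -/
theorem weakLimitL1_norm_phase_le (z : ℂ) : ‖conj z / (‖z‖ : ℂ)‖ ≤ 1 := by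
  rcases eq_or_ne z 0 with rfl | hz
  · simp
  · rw [norm_div, Complex.norm_conj, Complex.norm_real, Real.norm_of_nonneg (norm_nonneg z),
      div_self (norm_ne_zero_iff.2 hz)]

/-- `z · (z̄/|z|) = |z|` (also at `z = 0`, where both sides vanish). [folklore] -/
theorem weakLimitL1_mul_phase (z : ℂ) : z * (conj z / (‖z‖ : ℂ)) = (‖z‖ : ℂ) := by
  rcases eq_or_ne z 0 with rfl | hz
  · simp
  · have h : (‖z‖ : ℂ) ≠ 0 := Complex.ofReal_ne_zero.2 (norm_ne_zero_iff.2 hz)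
    rw [mul_div_assoc', Complex.mul_conj, div_eq_iff h, Complex.normSq_eq_norm_sq]
    push_cast; ring

/-- The phase map `z ↦ z̄/|z|` is measurable. [folklore] -/
theorem weakLimitL1_measurable_phase : Measurable fun z : ℂ => conj z / (‖z‖ : ℂ) :=
  Complex.continuous_conj.measurable.div
    (Complex.continuous_ofReal.measurable.comp continuous_norm.measurable)

/-- The exponential weight moves by at most the factor `e^{|b|δ}` over distances `< δ`:
`e^{b|y|} ≤ e^{b|x| + |b|δ}` if `dist y x < δ`. [folklore] -/
theorem weakLimitL1_exp_le_of_dist_lt {b δ x y : ℝ} (h : dist y x < δ) :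
    Real.exp (b * |y|) ≤ Real.exp (b * |x| + |b| * δ) := by
  rw [Real.dist_eq] at h
  refine Real.exp_le_exp.2 ?_
  have h1 : b * |y| - b * |x| ≤ |b| * δ :=
    calc b * |y| - b * |x| = b * (|y| - |x|) := by ring
      _ ≤ |b * (|y| - |x|)| := le_abs_self _
      _ = |b| * |(|y| - |x|)| := abs_mul _ _
      _ ≤ |b| * |y - x| :=
          mul_le_mul_of_nonneg_left (abs_abs_sub_abs_le_abs_sub y x) (abs_nonneg b)
      _ ≤ |b| * δ := mul_le_mul_of_nonneg_left h.le (abs_nonneg b)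
  linarith

/-- **Truncated phase test.** For locally integrable `v` and reals `b, R`, the function
`φ = 𝟙_{[-R,R]} · e^{b|t|} · v̄/|v|` is integrable with compact support, has modulus `≤ e^{b|t|}`,
vanishes off `[-R, R]`, and satisfies `v φ = 𝟙_{[-R,R]} |v| e^{b|t|}` pointwise. [folklore] -/
theorem weakLimitL1_exists_truncPhase {v : ℝ → ℂ} (hv : LocallyIntegrable v volume) (b R : ℝ) :
    ∃ φ : ℝ → ℂ, Integrable φ ∧ HasCompactSupport φ ∧
      (∀ t, ‖φ t‖ ≤ Real.exp (b * |t|)) ∧ (∀ t, t ∉ Icc (-R) R → φ t = 0) ∧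
      ∀ t, v t * φ t =
        (((Icc (-R) R).indicator (fun t => ‖v t‖ * Real.exp (b * |t|)) t : ℝ) : ℂ) := by
  have hKm : MeasurableSet (Icc (-R) R) := measurableSet_Icc
  have hwc : Continuous fun t : ℝ => Real.exp (b * |t|) := by fun_prop
  -- the untruncated phase-weight and its properties
  have hh_norm : ∀ t, ‖(Real.exp (b * |t|) : ℂ) * (conj (v t) / (‖v t‖ : ℂ))‖ ≤
      Real.exp (b * |t|) := fun t => by
    rw [norm_mul, Complex.norm_real, Real.norm_of_nonneg (Real.exp_pos _).le]
    exact mul_le_of_le_one_right (Real.exp_pos _).le (weakLimitL1_norm_phase_le _)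
  have hhm : AEStronglyMeasurable
      (fun t => (Real.exp (b * |t|) : ℂ) * (conj (v t) / (‖v t‖ : ℂ))) volume := by
    refine (Complex.continuous_ofReal.comp hwc).aestronglyMeasurable.mul ?_
    exact (weakLimitL1_measurable_phase.comp_aemeasurable
      hv.aestronglyMeasurable.aemeasurable).aestronglyMeasurable
  have hhK : IntegrableOn (fun t => (Real.exp (b * |t|) : ℂ) * (conj (v t) / (‖v t‖ : ℂ)))
      (Icc (-R) R) volume :=
    Integrable.mono' hwc.integrableOn_Icc hhm.restrict (ae_of_all _ hh_norm)
  refine ⟨(Icc (-R) R).indicator fun t => (Real.exp (b * |t|) : ℂ) * (conj (v t) / (‖v t‖ : ℂ)),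
    hhK.integrable_indicator hKm,
    HasCompactSupport.intro isCompact_Icc fun t ht => indicator_of_notMem ht _,
    fun t => ?_, fun t ht => indicator_of_notMem ht _, fun t => ?_⟩
  · by_cases ht : t ∈ Icc (-R) R
    · rw [indicator_of_mem ht]
      exact hh_norm t
    · rw [indicator_of_notMem ht, norm_zero]
      exact (Real.exp_pos _).le
  · by_cases ht : t ∈ Icc (-R) R
    · rw [indicator_of_mem ht, indicator_of_mem ht, mul_left_comm, weakLimitL1_mul_phase]
      push_cast
      ring
    · rw [indicator_of_notMem ht, indicator_of_notMem ht, mul_zero, Complex.ofReal_zero]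

/-- **Mollifier family.** For a locally integrable compactly supported `φ : ℝ → ℂ`, the
convolutions `g_n = ψ_n ⋆ φ` with the normalised bumps `ψ_n` of outer radius `r_n = 1/(n+1)`
(inner radius `r_n/2`) are Weil test functions, `r_n → 0`, `r_n ≤ 1`, `‖g_n(x)‖ ≤ ε` whenever
`‖φ‖ ≤ ε` on the ball of radius `r_n` about `x` (`dist_convolution_le`), and `g_n → φ` a.e.
(Lebesgue differentiation, `ContDiffBump.ae_convolution_tendsto_right_of_locallyIntegrable`).
[folklore] -/
theorem weakLimitL1_exists_mollifiers {φ : ℝ → ℂ} (hφli : LocallyIntegrable φ volume)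
    (hφc : HasCompactSupport φ) :
    ∃ (g : ℕ → ℝ → ℂ) (r : ℕ → ℝ), (∀ n, IsWeilTest (g n)) ∧ Tendsto r atTop (𝓝 0) ∧
      (∀ n, r n ≤ 1) ∧
      (∀ n x ε, 0 ≤ ε → (∀ y, dist y x < r n → ‖φ y‖ ≤ ε) → ‖g n x‖ ≤ ε) ∧
      ∀ᵐ x, Tendsto (fun n => g n x) atTop (𝓝 (φ x)) := by
  obtain ⟨β, hβout, hβin⟩ : ∃ β : ℕ → ContDiffBump (0 : ℝ),
      (∀ n, (β n).rOut = 1 / ((n : ℝ) + 1)) ∧ ∀ n, (β n).rIn = 1 / (2 * ((n : ℝ) + 1)) :=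
    ⟨fun n => ⟨(1 : ℝ) / (2 * ((n : ℝ) + 1)), 1 / ((n : ℝ) + 1), by positivity,
      by rw [div_lt_div_iff_of_pos_left one_pos (by positivity) (by positivity)]; linarith⟩,
      fun n => rfl, fun n => rfl⟩
  have hβ0 : Tendsto (fun n => (β n).rOut) atTop (𝓝 0) := by
    simp only [hβout]
    exact tendsto_one_div_add_atTop_nhds_zero_nat
  have hβ2 : ∀ n, (β n).rOut ≤ 2 * (β n).rIn := fun n => by
    rw [hβout, hβin]
    apply le_of_eq
    field_simp
  have hβ1 : ∀ n, (β n).rOut ≤ 1 := fun n => by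
    have hn : (0 : ℝ) ≤ n := n.cast_nonneg
    rw [hβout, div_le_one (by positivity)]
    linarith
  have hφm : AEStronglyMeasurable φ volume := hφli.aestronglyMeasurable
  refine ⟨fun n => (β n).normed volume ⋆[ContinuousLinearMap.lsmul ℝ ℝ, volume] φ,
    fun n => (β n).rOut, fun n => ⟨?_, ?_⟩, hβ0, hβ1, fun n x ε hε hball => ?_, ?_⟩
  · exact (β n).hasCompactSupport_normed.contDiff_convolution_left _ (β n).contDiff_normed hφli
  · exact (β n).hasCompactSupport_normed.convolution _ hφc
  · have h := dist_convolution_le (μ := volume) (z₀ := (0 : ℂ)) hε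
      (β n).support_normed_eq.subset (β n).nonneg_normed (β n).integral_normed hφm
      (fun y hy => by rw [dist_zero_right]; exact hball y (Metric.mem_ball.1 hy))
    rwa [dist_zero_right] at h
  · exact ContDiffBump.ae_convolution_tendsto_right_of_locallyIntegrable hβ0
      (Eventually.of_forall hβ2) hφli

/-- **Window bound.** Under the hypotheses of `stub_weightedL1_of_weakLimit` (bounded weighted
`L¹` norms of `f_k`, weak convergence to the locally integrable `v` against Weil tests), every
truncated weighted norm of the limit obeys `∫_{[-R,R]} ‖v‖ e^{b|t|} ≤ M` (test the mollified
truncated phase, pass to the weak limit, then remove the mollification by dominated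
convergence). [folklore] -/
theorem weakLimitL1_setIntegral_le {f : ℕ → ℝ → ℂ} {v : ℝ → ℂ} {b M : ℝ}
    (hfi : ∀ k, Integrable (fun t : ℝ => ‖f k t‖ * Real.exp (b * |t|)))
    (hfM : ∀ k, ∫ t, ‖f k t‖ * Real.exp (b * |t|) ≤ M)
    (hv : LocallyIntegrable v volume)
    (hw : ∀ g : ℝ → ℂ, IsWeilTest g →
      Tendsto (fun k => ∫ t, f k t * g t) atTop (𝓝 (∫ t, v t * g t)))
    (R : ℝ) :
    ∫ t in Icc (-R) R, ‖v t‖ * Real.exp (b * |t|) ≤ M := by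
  obtain ⟨φ, hφi, hφc, hφ_norm, hφ_zero, hvφ⟩ := weakLimitL1_exists_truncPhase hv b R
  obtain ⟨g, r, hg_test, hr0, hr1, hg_le, hg_ae⟩ :=
    weakLimitL1_exists_mollifiers hφi.locallyIntegrable hφc
  -- bound A: `‖g n x‖ ≤ e^{b|x| + |b| r_n}`
  have hgA : ∀ n x, ‖g n x‖ ≤ Real.exp (b * |x| + |b| * r n) := fun n x =>
    hg_le n x _ (Real.exp_pos _).le fun y hy =>
      (hφ_norm y).trans (weakLimitL1_exp_le_of_dist_lt hy)
  -- bound B, uniform in `n`: `‖g n x‖ ≤ 𝟙_{[-R-1,R+1]}(x) e^{b|x| + |b|}`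
  have hgB : ∀ n x, ‖g n x‖ ≤
      (Icc (-(R + 1)) (R + 1)).indicator (fun x => Real.exp (b * |x| + |b|)) x := by
    intro n x
    by_cases hx : x ∈ Icc (-(R + 1)) (R + 1)
    · rw [indicator_of_mem hx]
      refine hg_le n x _ (Real.exp_pos _).le fun y hy => (hφ_norm y).trans ?_
      refine (weakLimitL1_exp_le_of_dist_lt hy).trans (Real.exp_le_exp.2 ?_)
      have := mul_le_mul_of_nonneg_left (hr1 n) (abs_nonneg b)
      linarith
    · rw [indicator_of_notMem hx]
      refine hg_le n x 0 le_rfl fun y hy => ?_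
      have hyK : y ∉ Icc (-R) R := by
        intro hyK
        apply hx
        rw [Real.dist_eq, abs_sub_comm] at hy
        rw [mem_Icc, ← abs_le] at hyK
        rw [mem_Icc, ← abs_le]
        have := abs_sub_abs_le_abs_sub x y
        linarith [hr1 n]
      rw [hφ_zero y hyK, norm_zero]
  -- Step 1: `‖∫ v g_n‖ ≤ e^{|b| r_n} M` from the weak limit
  have h1 : ∀ n, ‖∫ t, v t * g n t‖ ≤ Real.exp (|b| * r n) * M := by
    intro n
    refine le_of_tendsto' (hw (g n) (hg_test n)).norm fun k => ?_
    calc ‖∫ t, f k t * g n t‖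
        ≤ ∫ t, ‖f k t‖ * Real.exp (b * |t|) * Real.exp (|b| * r n) := by
          refine norm_integral_le_of_norm_le ((hfi k).mul_const _) (ae_of_all _ fun t => ?_)
          rw [norm_mul, mul_assoc, ← Real.exp_add]
          exact mul_le_mul_of_nonneg_left (hgA n t) (norm_nonneg _)
      _ = (∫ t, ‖f k t‖ * Real.exp (b * |t|)) * Real.exp (|b| * r n) :=
          integral_mul_const _ _
      _ ≤ M * Real.exp (|b| * r n) := mul_le_mul_of_nonneg_right (hfM k) (Real.exp_pos _).le
      _ = Real.exp (|b| * r n) * M := mul_comm _ _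
  -- Step 2: `∫ v g_n → ∫ v φ` by dominated convergence
  have h2 : Tendsto (fun n => ∫ t, v t * g n t) atTop (𝓝 (∫ t, v t * φ t)) := by
    refine tendsto_integral_of_dominated_convergence
      ((Icc (-(R + 1)) (R + 1)).indicator fun x => ‖v x‖ * Real.exp (b * |x| + |b|)) ?_ ?_ ?_ ?_
    · exact fun n => hv.aestronglyMeasurable.mul (hg_test n).1.continuous.aestronglyMeasurable
    · rw [integrable_indicator_iff (measurableSet_Icc : MeasurableSet (Icc (-(R + 1)) (R + 1)))]
      exact IntegrableOn.mul_continuousOn (hv.integrableOn_isCompact isCompact_Icc).norm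
        (Continuous.continuousOn (by fun_prop)) isCompact_Icc
    · refine fun n => ae_of_all _ fun x => ?_
      rw [norm_mul]
      exact (mul_le_mul_of_nonneg_left (hgB n x) (norm_nonneg _)).trans_eq
        (indicator_mul_right (Icc (-(R + 1)) (R + 1)) (fun x => ‖v x‖)
          (fun x => Real.exp (b * |x| + |b|))).symm
    · filter_upwards [hg_ae] with x hx
      exact hx.const_mul (v x)
  -- Step 3: pass to the limit in the bounds
  have h3 : ‖∫ t, v t * φ t‖ ≤ M := by
    have hc : Tendsto (fun n => Real.exp (|b| * r n) * M) atTop (𝓝 M) := by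
      have := ((Real.continuous_exp.tendsto _).comp (hr0.const_mul |b|)).mul_const M
      simpa using this
    exact le_of_tendsto_of_tendsto' h2.norm hc h1
  -- Step 4: identify `∫ v φ` with the truncated weighted norm
  have h4 : ∫ t, v t * φ t = ((∫ t in Icc (-R) R, ‖v t‖ * Real.exp (b * |t|) : ℝ) : ℂ) := by
    simp_rw [hvφ]
    rw [integral_complex_ofReal, integral_indicator measurableSet_Icc]
  rw [h4, Complex.norm_real, Real.norm_of_nonneg
    (setIntegral_nonneg measurableSet_Icc fun t _ => by positivity)] at h3
  exact h3

/-- (H5) **Weighted `L¹` norms are weakly lower semicontinuous.** If `f_k : ℝ → ℂ` are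
measurable with `∫ ‖f_k‖ e^{b|t|} ≤ M` and converge to a locally integrable `v` weakly against
Weil test functions (`∫ f_k g → ∫ v g` for all smooth compactly supported `g`), then
`‖v‖ e^{b|t|}` is integrable and `∫ ‖v‖ e^{b|t|} ≤ M` (window bound
`weakLimitL1_setIntegral_le` on `[-n, n]`, then `n → ∞` along the `AECover` by monotone
exhaustion). [folklore] -/
theorem stub_weightedL1_of_weakLimit :
    ∀ (f : ℕ → ℝ → ℂ) (v : ℝ → ℂ) (b M : ℝ),
      (∀ k, AEStronglyMeasurable (f k) volume) →
      (∀ k, Integrable (fun t : ℝ => ‖f k t‖ * Real.exp (b * |t|))) →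
      (∀ k, ∫ t, ‖f k t‖ * Real.exp (b * |t|) ≤ M) →
      LocallyIntegrable v volume →
      (∀ g : ℝ → ℂ, IsWeilTest g →
        Tendsto (fun k => ∫ t, f k t * g t) atTop (𝓝 (∫ t, v t * g t))) →
      Integrable (fun t : ℝ => ‖v t‖ * Real.exp (b * |t|)) ∧
        ∫ t, ‖v t‖ * Real.exp (b * |t|) ≤ M := by
  intro f v b M _ hfi hfM hv hw
  have hwc : Continuous fun t : ℝ => Real.exp (b * |t|) := by fun_prop
  have hcover : AECover volume atTop fun n : ℕ => Icc (-(n : ℝ)) n :=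
    aecover_Icc (tendsto_neg_atTop_atBot.comp tendsto_natCast_atTop_atTop)
      tendsto_natCast_atTop_atTop
  have hGi : ∀ n : ℕ,
      IntegrableOn (fun t : ℝ => ‖v t‖ * Real.exp (b * |t|)) (Icc (-(n : ℝ)) n) volume :=
    fun n => IntegrableOn.mul_continuousOn (hv.integrableOn_isCompact isCompact_Icc).norm
      hwc.continuousOn isCompact_Icc
  have hwin : ∀ n : ℕ, ∫ t in Icc (-(n : ℝ)) n, ‖v t‖ * Real.exp (b * |t|) ≤ M := fun n =>
    weakLimitL1_setIntegral_le hfi hfM hv hw n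
  have hint : Integrable (fun t : ℝ => ‖v t‖ * Real.exp (b * |t|)) :=
    hcover.integrable_of_integral_bounded_of_nonneg_ae M hGi
      (ae_of_all _ fun t => by positivity) (Eventually.of_forall hwin)
  exact ⟨hint, le_of_tendsto' (hcover.integral_tendsto_of_countably_generated hint) hwin⟩

end Summit.RiemannHypothesis.RiemannHypothesis.Theorems.GroundStatesConvergeToXi

end
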